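import Literature.NumberTheory.EllipticCurves.ZpExtensionGaloisTwistLevelProofs
import Literature.NumberTheory.EllipticCurves.ZpExtensionGaloisTwistTateDualProofs
import Literature.NumberTheory.GaloisRepresentations.ContinuousH1ResCocycle
import Literature.Barriers.BirchSwinnertonDyer.DescentDefectUnboundedMatsunoCor33Proofs
import HarnessLib

/-!
# Change of level on the DUAL side: `H¹(ι^D) y = 0` for a class `y ∈ H¹(Γ_K, E[p^J](χ_u)^D)` killed by
# `p^{J−j}` and locally trivial at a place with small twisted invariants (proofs)

Topic `NumberTheory/EllipticCurves`; namespace `WeierstrassCurve`. THEOREMS ONLY (no definition, no named fact,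
no instance; D-0026) — second proofs file of `ZpExtensionGaloisTwistLevel.lean` (the maps
`ι = W.twistedTorsionIncl`, `π = W.twistedTorsionMulPow`, `ι^D = W.twistedTorsionInclDual` between the twisted
torsion modules `M_j = E[p^j](χ_u) ⊆ M_J = E[p^J](χ_u)`, `j ≤ J`, and the Tate dual
`M_J^D = Hom(E[p^J], μ_{p^J})`).

Cell `bsd-2adic`, design memo HOME/t42/DESIGN-T42-ADDENDUM-17 §A17 (brick (β1)(ii)(iii) on the dual side). In
Greenberg's proof of Prop. 4.14/4.15 (LNM 1716 pp. 123–125) the Poitou–Tate obstruction to the global lift of a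
local target `t` of level `j` is its pairing `∑_v ⟨ι_* t_v, y_v⟩_v = ∑_v ⟨t_v, (ι^D)_* y_v⟩_v` with the dual
Selmer classes `y ∈ H¹_{𝓕^*}(K, M_J^D)` (adjunction: sibling file `ZpExtensionGaloisTwistLevelProofs`). This
file kills `(ι^D)_* y` DIRECTLY ON THE DUAL MODULE, without identifying `M_J^D` with `E[p^J](χ_{u'})`:

* **`map_twistedTorsionInclDual_eq_zero_of_res_eq_zero`** — if `p^{J−j} · y = 0`, the restriction of `y` to
  `Γ_E` vanishes for some `K`-field `E` (a completion at an omitted prime `v₀`, where the dual condition is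
  STRICT, Greenberg p. 123 «`σ|_{G_{F_{v₀}}}` is trivial»), and the twisted `Γ_E`-invariants of `M_J^D` are
  killed by `p^f` with `f ≤ j` (Greenberg p. 125 «`H⁰(F_{v₀}, M^*)` finite … true for all but finitely many
  `s`»), then `H¹(ι^D) y = 0` in `H¹(Γ_K, M_j^D)`.

Cocycle proof: `p^{J−j} φ = ∂m`, `φ|_{Γ_E} = ∂m₀` ⟹ `m − p^{J−j} m₀ ∈ (M_J^D)^{Γ_E}` ⟹ `p^f (m − p^{J−j} m₀) = 0`
⟹ `p^j m = 0` (as `p^J m₀ = 0`), i.e. `m` kills `p^j E[p^J] ⊇ E[p^J][p^{J−j}] = ker π` (divisibility of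
`E[p^∞]`, `exists_pow_nsmul_eq_geomPrimaryTorsion`); so `m = m' ∘ π` for an `m' ∈ Hom(E[p^j], μ)` (`π` onto by
divisibility), and `ι^D ∘ φ = ∂m'` because `φ(g)(ι S) = φ(g)(p^{J−j} S₁) = (∂m)(g)(S₁)` for `π S₁ = S`. The only
arithmetic input is the divisibility of `E(K̄)` (`W.zsmul_geomPoints_surjective`, a hypothesis — proved in the
tree as `zsmul_geomPoints_surjective_holds`).

References: R. Greenberg, LNM 1716 (1999), §4 pp. 123–125 [GreenbergLNM1716]; J.-P. Serre, *Galois Cohomology*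
(1997), I §2 [SerreGaloisCohomology1997]; J. S. Milne, *Arithmetic Duality Theorems* (2006), I §2
[MilneADT2006].
-/

noncomputable section

open CategoryTheory Field
open scoped ContRepresentation

universe u

namespace WeierstrassCurve

open Literature.NumberTheory.EllipticCurves Literature.NumberTheory.GaloisRepresentations
open Literature.NumberTheory.GaloisRepresentations.DiscreteGaloisModule (TateDual tateDual MuCarrier)

variable {K : Type u} [Field K] (W : WeierstrassCurve K) [W.IsElliptic] (p : ℕ) [Fact p.Prime]
  (κ : ZpExtension K p) {j J : ℕ} (hjJ : j ≤ J) (u : ℤ) (hu : (p : ℤ) ∣ u - 1)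

/-! ## Divisibility: `π` is onto and `ker π ⊆ p^j · E[p^J]` -/

/-- **`π : E[p^J] → E[p^j]`, `P ↦ p^{J−j} P`, is onto**, granted the divisibility of `E(K̄)`
(Silverman *AEC* III.4.2 (a); the tree's `zsmul_geomPoints_surjective`). [cite: SilvermanAEC2009, Prop. III.4.2 (a)] -/
theorem twistedTorsionMulPow_surjective (hdiv : W.zsmul_geomPoints_surjective) :
    Function.Surjective (W.twistedTorsionMulPow p κ hjJ u hu) := by
  intro S
  obtain ⟨B, hB⟩ := Literature.Barriers.BirchSwinnertonDyer.exists_pow_nsmul_eq_geomPrimaryTorsion W p (e := J - j) hdiv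
    ⟨(S : W.geomPoints), Literature.Barriers.BirchSwinnertonDyer.geomTorsion_pow_le_geomPrimaryTorsion W p j S.2⟩
  have hBJ : (B : W.geomPoints) ∈ W.geomTorsion ((p ^ J : ℕ) : ℤ) := by
    refine (Submodule.mem_torsionBy_iff _ _).mpr ?_
    have hS : ((p ^ j : ℕ) : ℤ) • (S : W.geomPoints) = 0 := by
      have := (Submodule.mem_torsionBy_iff _ _).mp S.2
      exact this
    have hB' : p ^ (J - j) • (B : W.geomPoints) = S := by
      have := congrArg (fun R : W.geomPrimaryTorsion p ↦ (R : W.geomPoints)) hB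
      simpa only [AddSubmonoidClass.coe_nsmul] using this
    obtain ⟨k, hk⟩ := Nat.exists_eq_add_of_le hjJ
    have hJ : ((p ^ J : ℕ) : ℤ) = ((p ^ j : ℕ) : ℤ) * ((p ^ (J - j) : ℕ) : ℤ) := by
      rw [← Nat.cast_mul, ← pow_add, Nat.add_sub_cancel' hjJ]
    have hS' : p ^ j • (S : W.geomPoints) = 0 := by rw [← natCast_zsmul]; exact hS
    rw [hJ, mul_smul, natCast_zsmul, natCast_zsmul, hB', hS']
  refine ⟨⟨B, hBJ⟩, Subtype.ext ?_⟩
  rw [coe_twistedTorsionMulPow_apply, natCast_zsmul]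
  have := congrArg (fun R : W.geomPrimaryTorsion p ↦ (R : W.geomPoints)) hB
  simpa only [AddSubmonoidClass.coe_nsmul] using this

/-- **`ker π ⊆ p^j · E[p^J]`**: a point of `E[p^J]` killed by `p^{J−j}` is `p^j P₁` for some `P₁ ∈ E[p^J]`
(divisibility of `E(K̄)`). [cite: SilvermanAEC2009, Prop. III.4.2 (a)] -/
theorem exists_eq_pow_smul_of_twistedTorsionMulPow_eq_zero (hdiv : W.zsmul_geomPoints_surjective)
    {R : W.geomTorsion ((p ^ J : ℕ) : ℤ)} (hR : W.twistedTorsionMulPow p κ hjJ u hu R = 0) :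
    ∃ R₁ : W.geomTorsion ((p ^ J : ℕ) : ℤ), ((p ^ j : ℕ) : ℤ) • R₁ = R := by
  rw [twistedTorsionMulPow_apply_eq_zero_iff] at hR
  obtain ⟨B, hB⟩ := Literature.Barriers.BirchSwinnertonDyer.exists_pow_nsmul_eq_geomPrimaryTorsion W p (e := j) hdiv
    ⟨(R : W.geomPoints), Literature.Barriers.BirchSwinnertonDyer.geomTorsion_pow_le_geomPrimaryTorsion W p J R.2⟩
  have hB' : p ^ j • (B : W.geomPoints) = R := by
    have := congrArg (fun R : W.geomPrimaryTorsion p ↦ (R : W.geomPoints)) hB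
    simpa only [AddSubmonoidClass.coe_nsmul] using this
  have hR' : ((p ^ (J - j) : ℕ) : ℤ) • (R : W.geomPoints) = 0 := by
    have := congrArg (fun R : W.geomTorsion ((p ^ J : ℕ) : ℤ) ↦ (R : W.geomPoints)) hR
    simpa only [AddSubgroupClass.coe_zsmul, ZeroMemClass.coe_zero] using this
  have hBJ : (B : W.geomPoints) ∈ W.geomTorsion ((p ^ J : ℕ) : ℤ) := by
    refine (Submodule.mem_torsionBy_iff _ _).mpr ?_
    have hJ : ((p ^ J : ℕ) : ℤ) = ((p ^ (J - j) : ℕ) : ℤ) * ((p ^ j : ℕ) : ℤ) := by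
      rw [← Nat.cast_mul, ← pow_add, Nat.sub_add_cancel hjJ]
    have hR'' : p ^ (J - j) • (R : W.geomPoints) = 0 := by rw [← natCast_zsmul]; exact hR'
    rw [hJ, mul_smul, natCast_zsmul, natCast_zsmul, hB', hR'']
  exact ⟨⟨B, hBJ⟩, Subtype.ext (by rw [AddSubgroupClass.coe_zsmul, natCast_zsmul]; exact hB')⟩

/-- A homomorphism `m : E[p^J] → μ` killed by `p^j` vanishes on `ker π` (as `ker π ⊆ p^j E[p^J]`).
[cite: MilneADT2006, Ch. I §2] -/
theorem apply_eq_zero_of_twistedTorsionMulPow_eq_zero (hdiv : W.zsmul_geomPoints_surjective)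
    {m : TateDual K (W.geomTorsion ((p ^ J : ℕ) : ℤ)) (p ^ J)} (hm : ((p ^ j : ℕ) : ℤ) • m = 0)
    {R : W.geomTorsion ((p ^ J : ℕ) : ℤ)} (hR : W.twistedTorsionMulPow p κ hjJ u hu R = 0) : m R = 0 := by
  obtain ⟨R₁, rfl⟩ := W.exists_eq_pow_smul_of_twistedTorsionMulPow_eq_zero p κ hjJ u hu hdiv hR
  rw [map_zsmul, ← AddMonoidHom.zsmul_apply' m, hm]
  rfl
  where
  /-- `(c • m) R = c • m R` for the `ℤ`-module structure of the type synonym `TateDual`. -/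
  AddMonoidHom.zsmul_apply' (m : TateDual K (W.geomTorsion ((p ^ J : ℕ) : ℤ)) (p ^ J)) {c : ℤ}
      {R : W.geomTorsion ((p ^ J : ℕ) : ℤ)} : (c • m) R = c • m R := rfl

/-- **Descent of a homomorphism through `π`.** If `p^j · m = 0` for `m ∈ Hom(E[p^J], μ_{p^J})`, there is
`m' ∈ Hom(E[p^j], μ_{p^J})` with `m' (π P) = m P` for all `P` (`π` onto, `m` vanishes on `ker π`; divisibility
of `E(K̄)`). [cite: MilneADT2006, Ch. I §2] -/
theorem exists_tateDual_comp_twistedTorsionMulPow_eq (hdiv : W.zsmul_geomPoints_surjective)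
    {m : TateDual K (W.geomTorsion ((p ^ J : ℕ) : ℤ)) (p ^ J)} (hm : ((p ^ j : ℕ) : ℤ) • m = 0) :
    ∃ m' : TateDual K (W.geomTorsion ((p ^ j : ℕ) : ℤ)) (p ^ J),
      ∀ P, m' (W.twistedTorsionMulPow p κ hjJ u hu P) = m P := by
  have hsurj := W.twistedTorsionMulPow_surjective p κ hjJ u hu hdiv
  -- well-definedness on fibres of `π`
  have hwd : ∀ P Q, W.twistedTorsionMulPow p κ hjJ u hu P = W.twistedTorsionMulPow p κ hjJ u hu Q →
      m P = m Q := fun P Q h ↦ by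
    rw [← sub_eq_zero, ← map_sub]
    exact W.apply_eq_zero_of_twistedTorsionMulPow_eq_zero p κ hjJ u hu hdiv hm (by rw [map_sub, h, sub_self])
  refine ⟨AddMonoidHom.mk' (fun S ↦ m (Classical.choose (hsurj S))) fun S T ↦ ?_, fun P ↦ ?_⟩
  · rw [← map_add]
    apply hwd
    rw [map_add, Classical.choose_spec (hsurj S), Classical.choose_spec (hsurj T),
      Classical.choose_spec (hsurj (S + T))]
  · exact hwd _ _ (Classical.choose_spec (hsurj _))

section Dual

variable [Finite (W.geomTorsion ((p ^ j : ℕ) : ℤ))] [Finite (W.geomTorsion ((p ^ J : ℕ) : ℤ))]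

/-- **`H¹(ι^D) y = 0` for `p^{J−j} y = 0`, `y` locally trivial at a place whose twisted invariants of `M_J^D`
are killed by `p^f`, `f ≤ j`** (Greenberg p. 123 «`σ|_{G_{F_{v₀}}}` is trivial … Hence `σ` is trivial» with
p. 125 «`H⁰(F_{v₀}, M^*)` finite», at finite level, on the dual module, WITHOUT the Weil identification
`M^* = A_{−s}`): for a `K`-field `E` and `y ∈ H¹(Γ_K, E[p^J](χ_u)^D)` with `p^{J−j} · y = 0` and
`res_{Γ_E} y = 0`, if every element of `Hom(E[p^J], μ_{p^J})` fixed by the (Tate-dual twisted) action of `Γ_E`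
is killed by `p^f` with `f ≤ j`, then `H¹(ι^D) y = 0` in `H¹(Γ_K, E[p^j](χ_u)^D)`; granted the divisibility of
`E(K̄)`. [cite: GreenbergLNM1716, §4 pp. 123–125] [cite: SerreGaloisCohomology1997, I §2.2] -/
theorem map_twistedTorsionInclDual_eq_zero_of_res_eq_zero (hdiv : W.zsmul_geomPoints_surjective)
    {E : Type u} [Field E] [Algebra K E] {f : ℕ} (hfj : f ≤ j)
    (hinv : ∀ m : TateDual K (W.geomTorsion ((p ^ J : ℕ) : ℤ)) (p ^ J),
      (∀ σ : absoluteGaloisGroup E,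
        (W.twistedTorsionGaloisModule p κ J u hu).tateDual (p ^ J) (absGaloisRestrict K E σ) m = m) →
      ((p ^ f : ℕ) : ℤ) • m = 0)
    (y : galoisCohomology ((W.twistedTorsionGaloisModule p κ J u hu).tateDual (p ^ J)) 1)
    (hy : (p ^ (J - j)) • y = 0)
    (hloc : galoisCohomology.res ((W.twistedTorsionGaloisModule p κ J u hu).tateDual (p ^ J)) E 1 y = 0) :
    galoisCohomology.map (W.twistedTorsionInclDual p κ hjJ u hu) 1 y = 0 := by
  obtain ⟨φ, rfl⟩ := oneCocycleClass_surjective _ y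
  -- `p^{J-j} φ = ∂m`
  have hs := oneCocycleClass_smul ((W.twistedTorsionGaloisModule p κ J u hu).tateDual (p ^ J)).toTopRep ((p ^ (J - j) : ℕ) : ℤ) φ
  conv at hs => rhs; rw [Nat.cast_smul_eq_nsmul]
  have hy' : oneCocycleClass ((W.twistedTorsionGaloisModule p κ J u hu).tateDual (p ^ J)).toTopRep (((p ^ (J - j) : ℕ) : ℤ) • φ) = 0 := hs.trans hy
  rw [oneCocycleClass_eq_zero_iff] at hy'
  obtain ⟨m, hm⟩ := hy'
  have hm' : ∀ g : absoluteGaloisGroup K, ((p ^ (J - j) : ℕ) : ℤ) • φ.1 g = ((W.twistedTorsionGaloisModule p κ J u hu).tateDual (p ^ J)) g m - m := fun g ↦ hm g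
  -- `φ|_{Γ_E} = ∂m₀`
  rw [galoisCohomology.res_one_oneCocycleClass] at hloc
  obtain ⟨m₀, hm₀⟩ := (oneCocycleClass_eq_zero_iff _ _).mp hloc
  have hm₀' : ∀ σ : absoluteGaloisGroup E, φ.1 (absGaloisRestrict K E σ) =
      ((W.twistedTorsionGaloisModule p κ J u hu).tateDual (p ^ J)) (absGaloisRestrict K E σ) m₀ - m₀ := fun σ ↦ hm₀ σ
  -- `m - p^{J-j} m₀` is a twisted `Γ_E`-invariant, hence killed by `p^f`
  have hfix : ∀ σ : absoluteGaloisGroup E,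
      ((W.twistedTorsionGaloisModule p κ J u hu).tateDual (p ^ J)) (absGaloisRestrict K E σ) (m - ((p ^ (J - j) : ℕ) : ℤ) • m₀) =
        m - ((p ^ (J - j) : ℕ) : ℤ) • m₀ :=
    fun σ ↦ by
    have h1 := hm' (absGaloisRestrict K E σ)
    rw [hm₀' σ, smul_sub] at h1
    have h2 : ((W.twistedTorsionGaloisModule p κ J u hu).tateDual (p ^ J)) (absGaloisRestrict K E σ) m =
        ((p ^ (J - j) : ℕ) : ℤ) • ((W.twistedTorsionGaloisModule p κ J u hu).tateDual (p ^ J)) (absGaloisRestrict K E σ) m₀ -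
          ((p ^ (J - j) : ℕ) : ℤ) • m₀ + m := by
      rw [h1, sub_add_cancel]
    rw [map_sub, map_zsmul, h2]
    abel
  have hkill : ((p ^ f : ℕ) : ℤ) • (m - ((p ^ (J - j) : ℕ) : ℤ) • m₀) = 0 := hinv _ hfix
  -- hence `p^j m = 0`
  have hjm : ((p ^ j : ℕ) : ℤ) • m = 0 := by
    obtain ⟨k, hk⟩ := Nat.exists_eq_add_of_le hfj
    have hjk : ((p ^ j : ℕ) : ℤ) = ((p ^ k : ℕ) : ℤ) * ((p ^ f : ℕ) : ℤ) := by
      rw [hk, pow_add, Nat.cast_mul, mul_comm]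
    have hJ : ((p ^ j : ℕ) : ℤ) * ((p ^ (J - j) : ℕ) : ℤ) = ((p ^ J : ℕ) : ℤ) := by
      rw [← Nat.cast_mul, ← pow_add, Nat.add_sub_cancel' hjJ]
    have h1 : ((p ^ j : ℕ) : ℤ) • (m - ((p ^ (J - j) : ℕ) : ℤ) • m₀) = 0 := by
      rw [hjk, mul_smul, hkill, smul_zero]
    have h2 : ((p ^ j : ℕ) : ℤ) • (((p ^ (J - j) : ℕ) : ℤ) • m₀) = 0 := by
      rw [smul_smul, hJ, natCast_zsmul]
      exact ZpExtension.pow_nsmul_tateDual_eq_zero (W.pow_nsmul_geomTorsion_pow p J) (p ^ J) m₀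
    rw [smul_sub, h2, sub_zero] at h1
    exact h1
  -- descend `m` through `π`: `m = m' ∘ π`
  obtain ⟨m', hm'π⟩ := W.exists_tateDual_comp_twistedTorsionMulPow_eq p κ hjJ u hu hdiv hjm
  -- and `ι^D ∘ φ = ∂m'`
  rw [galoisCohomology.map_one_oneCocycleClass]
  refine (oneCocycleClass_eq_zero_iff _ _).mpr ⟨m', fun g ↦ ?_⟩
  refine TateDual.ext fun S ↦ ?_
  obtain ⟨S₁, rfl⟩ := W.twistedTorsionMulPow_surjective p κ hjJ u hu hdiv S
  change W.twistedTorsionInclDual p κ hjJ u hu (φ.1 g) (W.twistedTorsionMulPow p κ hjJ u hu S₁) =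
    ((W.twistedTorsionGaloisModule p κ j u hu).tateDual (p ^ J) g m' - m') (W.twistedTorsionMulPow p κ hjJ u hu S₁)
  rw [twistedTorsionInclDual_apply_apply, twistedTorsionIncl_mulPow, map_zsmul]
  -- LHS: `(p^{J-j} • φ g) S₁ = (ρD g m - m) S₁`
  have hL : ((p ^ (J - j) : ℕ) : ℤ) • φ.1 g S₁ = (((W.twistedTorsionGaloisModule p κ J u hu).tateDual (p ^ J)) g m - m) S₁ := by
    rw [← hm' g]; rfl
  rw [hL]
  -- RHS: unfold the Tate-dual action and use `m' ∘ π = m`, `π` equivariant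
  change (((W.twistedTorsionGaloisModule p κ J u hu).tateDual (p ^ J)) g m) S₁ - m S₁ =
    ((W.twistedTorsionGaloisModule p κ j u hu).tateDual (p ^ J) g m') (W.twistedTorsionMulPow p κ hjJ u hu S₁) -
      m' (W.twistedTorsionMulPow p κ hjJ u hu S₁)
  rw [hm'π, DiscreteGaloisModule.tateDual_apply_apply_apply, DiscreteGaloisModule.tateDual_apply_apply_apply,
    ← twistedTorsionMulPow_apply_twist, hm'π]

end Dual

end WeierstrassCurve

end
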